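import Literature.NumberTheory.LFunctions.SuzukiConditionalWindowsProofs
import Literature.Analysis.OperatorTheory.L2KernelIntegralOperator
import Literature.Analysis.OperatorTheory.CompactPositiveTopLevel
import HarnessLib

/-!
# Suzuki 2021, Prop. 4.4 ii)–iii) (`‖𝖪_ζ^{ω,ν}[t]‖ < 1` under `E ∈ HB̄`):
# discharge of `Suzuki2021_prop44_norm`

LINE 1 — LABEL: RH-FREE AS TYPED (an operator-norm statement about one explicit integral kernel
UNDER the explicit hypothesis `E_ζ^{ω,ν} ∈ HB̄`; for `ω > ½` that hypothesis is a tree theorem, for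
`ω < ½` it is of RH strength and stays a hypothesis). FRAMING (cell rh-crit, D-0074): corpus
theorems are RH-FREE literature; nothing here is worded as progress toward RH. bears_on: B-C/B-P
(LADDER-RH COLUMN 6 DBR — [Su21] §4.4; the statement is the rh-dbr column's `OpNormWindow ω ν t`,
whose certified instances `‖𝖪[T]‖ < 1` are that column's data). WHAT THIS IS NOT: not a value or a
bound for the norm (only `< 1`), not Lemma 3.2's isometry, not a criterion or a route; nothing here
bears on the truth of RH.

M. Suzuki, *Hamiltonians arising from L-functions in the Selberg class*, J. Funct. Anal. 281 (2021)
109116 = arXiv:1606.05726 [Suzuki2021Hamiltonians], Prop. 4.4 (p. 22–23), for `L = ζ`, under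
`E ∈ HB̄` and (2.8): «ii) `‖𝖪[t]f‖ ≠ ‖f‖` for every `0 ≠ f ∈ L²(−∞,t)`, and iii) `‖𝖪[t]‖ < 1`»
(printed with the typo `‖𝖧_{ω,a}‖`). The tree's named fact `Suzuki2021_prop44_norm`
(`SuzukiCanonicalSystem.lean`) records both clauses for the block
`B f = 𝖯_t ∫_{(−t,t)}K(·+y)f(y)dy` of `𝖪[t]` on `L²(−t,t)`; clause ii) is the tree theorem
`Suzuki2021_prop44_ii` (`SuzukiConditionalWindowsProofs.lean`). This file proves clause iii) and
assembles `Suzuki2021_prop44_norm_holds`.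

## The printed proof of iii) and how it is followed

Printed: «We have `‖𝖪[t]‖ ≤ 1` by `‖𝖪[t]f‖ ≤ ‖𝖯_t𝖪𝖯_t f‖ ≤ ‖f‖`. Suppose that `‖𝖪[t]‖ = 1`. Because
`𝖪[t]` is compact [Hilbert–Schmidt, Lemma 3.3] and self-adjoint, its norm is attained: there exists
`f ≠ 0` with `‖𝖪[t]f‖ = ‖f‖`, which contradicts ii).» Followed step for step on the Hilbert space
`Lp ℝ 2 (volume.restrict (Ioo (−t) t))`: the block `B` is the tree's integral operator with the
square-integrable kernel `K(x+y)` (`Literature.Analysis.OperatorTheory.exists_l2KernelOp_package`: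
existence, compactness, self-adjointness); `‖B‖ ≤ 1` is the contraction
`SuzukiConditionalWindows.kernelImage_contraction`; norm attainment is applied to the compact
POSITIVE operator `B∘B`
(`Literature.Analysis.OperatorTheory.exists_eigenvector_norm_of_re_inner_nonneg`, Reed–Simon I
Thm. VI.16) together with the C*-identity `‖B∘B‖ = ‖B‖²`; `‖B‖ = 1` then yields a unit
`Ω` with `‖BΩ‖ = ‖Ω‖`, contradicting ii). Then `c = ‖B‖² < 1`.

## Main result

* `Literature.NumberTheory.LFunctions.Suzuki2021_prop44_norm_holds : Suzuki2021_prop44_norm`.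

## References

* [Suzuki2021Hamiltonians] M. Suzuki, J. Funct. Anal. 281 (2021) 109116 = arXiv:1606.05726, §4.4
  Prop. 4.4 ii)–iii) and its proof; Lemma 3.3 (Hilbert–Schmidt).
* [ReedSimonI1980] M. Reed, B. Simon, *Methods of Modern Mathematical Physics I*, Thm. VI.16,
  Thm. VI.22–VI.23.
-/

noncomputable section

open Complex MeasureTheory Filter Topology Set Metric Function
open scoped Real RealInnerProductSpace

namespace Literature.NumberTheory.LFunctions

namespace SuzukiWindowNorm

open Literature.Analysis.OperatorTheory SuzukiConditionalWindows

/-- The kernel `(x,y) ↦ K(x+y)` of `𝖪[t]` is square integrable on `(−t,t)²` for continuous `K`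
(indeed bounded — [Su21] Lemma 3.3: `𝖪[t]` is Hilbert–Schmidt).
[cite: Suzuki2021Hamiltonians, Lemma 3.3] -/
theorem memLp_two_kernel {K : ℝ → ℝ} (hK : Continuous K) (t : ℝ) :
    MemLp (uncurry fun x y : ℝ ↦ K (x + y)) 2
      ((volume.restrict (Ioo (-t) t)).prod (volume.restrict (Ioo (-t) t))) := by
  haveI : IsFiniteMeasure (volume.restrict (Ioo (-t) t)) :=
    isFiniteMeasure_restrict.2 measure_Ioo_lt_top.ne
  obtain ⟨C, hC⟩ := (isCompact_Icc (a := -(2 * |t|)) (b := 2 * |t|)).exists_bound_of_continuousOn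
    hK.continuousOn
  have hmeas : AEStronglyMeasurable (uncurry fun x y : ℝ ↦ K (x + y))
      ((volume.restrict (Ioo (-t) t)).prod (volume.restrict (Ioo (-t) t))) :=
    (hK.comp (continuous_fst.add continuous_snd)).aestronglyMeasurable
  refine MemLp.of_bound hmeas C ?_
  rw [Measure.prod_restrict]
  filter_upwards [ae_restrict_mem (measurableSet_Ioo.prod measurableSet_Ioo)] with p hp
  obtain ⟨⟨h1, h2⟩, ⟨h3, h4⟩⟩ := hp
  refine hC (p.1 + p.2) ⟨?_, ?_⟩ <;> cases abs_cases t <;> linarith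

/-- The square of the `L²(−t,t)`-norm of `hf.toLp f`. [folklore] -/
private theorem norm_toLp_sq {μ : Measure ℝ} {f : ℝ → ℝ} (hf : MemLp f 2 μ) :
    ‖hf.toLp f‖ ^ 2 = ∫ y, f y ^ 2 ∂μ := by
  rw [norm_toLp_sq_eq_integral_norm_sq hf]
  simp [sq_abs]

/-- The square of the norm of an `L²` class is the integral of its square. [folklore] -/
private theorem norm_Lp_sq {μ : Measure ℝ} (φ : Lp ℝ 2 μ) :
    ‖φ‖ ^ 2 = ∫ y, (φ : ℝ → ℝ) y ^ 2 ∂μ := by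
  conv_lhs => rw [← Lp.toLp_coeFn φ (Lp.memLp φ)]
  exact norm_toLp_sq (Lp.memLp φ)

/-- For `t > 0` the space `L²(−t,t)` is non-trivial (the constant `1` has norm `√(2t) ≠ 0`).
[folklore] -/
private theorem nontrivial_Lp {t : ℝ} (ht : 0 < t) :
    Nontrivial (Lp ℝ 2 (volume.restrict (Ioo (-t) t))) := by
  haveI : IsFiniteMeasure (volume.restrict (Ioo (-t) t)) :=
    isFiniteMeasure_restrict.2 measure_Ioo_lt_top.ne
  have h1 : MemLp (fun _ : ℝ ↦ (1 : ℝ)) 2 (volume.restrict (Ioo (-t) t)) := memLp_const 1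
  refine ⟨⟨h1.toLp _, 0, fun h0 ↦ ?_⟩⟩
  have hn : ‖h1.toLp _‖ ^ 2 = ∫ y in Ioo (-t) t, (1 : ℝ) ^ 2 := norm_toLp_sq h1
  rw [h0, norm_zero] at hn
  simp only [one_pow, ne_eq, OfNat.ofNat_ne_zero, not_false_eq_true, zero_pow,
    integral_const, smul_eq_mul, mul_one] at hn
  have hpos : 0 < (volume.restrict (Ioo (-t) t)).real univ := by
    rw [measureReal_def, Measure.restrict_apply MeasurableSet.univ, univ_inter, Real.volume_Ioo,
      ENNReal.toReal_ofReal (by linarith)]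
    linarith
  linarith

/-- **[Su21] Prop. 4.4 iii), the operator step**: on `L²(−t,t)` (`t > 0`), under `E ∈ HB̄` and
(2.8), there is `c < 1` with `∫(𝖪[t]f)² ≤ c∫f²` for all `f ∈ L²(−t,t)` — compactness and
self-adjointness of the block of `𝖪[t]`, the contraction `‖𝖪[t]‖ ≤ 1`, norm attainment for
`𝖪[t]²`, and clause ii).
[cite: Suzuki2021Hamiltonians, Prop. 4.4 iii) (proof)] -/
theorem exists_lt_one_bound {ω : ℝ} (hω : 0 < ω) {ν : ℕ} (hν : 1 ≤ ν) (hνω : 1 < (ν : ℝ) * ω)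
    (hE : IsSuzukiHBbar (suzukiE ω ν)) {t : ℝ} (ht : 0 < t) :
    ∃ c : ℝ, c < 1 ∧ ∀ f : ℝ → ℝ, MemLp f 2 (volume.restrict (Ioo (-t) t)) →
      ∫ x in Ioo (-t) t, (∫ y in Ioo (-t) t, suzukiKernel ω ν (x + y) * f y) ^ 2 ≤
        c * ∫ x in Ioo (-t) t, f x ^ 2 := by
  set μ : Measure ℝ := volume.restrict (Ioo (-t) t) with hμ
  haveI : IsFiniteMeasure μ := isFiniteMeasure_restrict.2 measure_Ioo_lt_top.ne
  haveI : Nontrivial (Lp ℝ 2 μ) := nontrivial_Lp ht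
  set K : ℝ → ℝ := suzukiKernel ω ν with hKdef
  have hKc : Continuous K := suzuki2021_prop41_iv hω ν hνω
  have hK2 : MemLp (uncurry fun x y : ℝ ↦ K (x + y)) 2 (μ.prod μ) := memLp_two_kernel hKc t
  obtain ⟨⟨A, hA⟩, hprops⟩ := exists_l2KernelOp_package hK2
  obtain ⟨hcomp, hsa, -, -⟩ := hprops A hA
  have hsa' : IsSelfAdjoint A := hsa fun x y ↦ by simp only [add_comm]
  -- `‖Aφ‖² = ∫(∫K(x+y)φ(y))²`
  have hnormA : ∀ φ : Lp ℝ 2 μ,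
      ‖A φ‖ ^ 2 = ∫ x in Ioo (-t) t, (∫ y in Ioo (-t) t, K (x + y) * φ y) ^ 2 := by
    intro φ
    rw [norm_Lp_sq]
    refine integral_congr_ae ?_
    filter_upwards [hA φ] with x hx
    rw [hx]
  -- the image of `toLp f` is the image of `f`
  have himg : ∀ (f : ℝ → ℝ) (hf : MemLp f 2 μ) (x : ℝ),
      ∫ y in Ioo (-t) t, K (x + y) * (hf.toLp f) y = ∫ y in Ioo (-t) t, K (x + y) * f y := by
    intro f hf x
    refine integral_congr_ae ?_
    filter_upwards [hf.coeFn_toLp] with y hy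
    rw [hy]
  -- the contraction `‖A φ‖ ≤ ‖φ‖`
  have hA1 : ∀ φ : Lp ℝ 2 μ, ‖A φ‖ ≤ ‖φ‖ := by
    intro φ
    have hφ : MemLp (φ : ℝ → ℝ) 2 μ := Lp.memLp φ
    obtain ⟨hh2, hcontr⟩ : MemLp (fun x ↦ ∫ y in Ioo (-t) t, K (x + y) * (φ : ℝ → ℝ) y) 2 volume ∧
        ∫ x : ℝ, (∫ y in Ioo (-t) t, K (x + y) * (φ : ℝ → ℝ) y) ^ 2 ≤ ∫ y in Ioo (-t) t,
          (φ : ℝ → ℝ) y ^ 2 :=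
      kernelImage_contraction hω hν hνω hE ht.le hφ
    have hsq : Integrable (fun x ↦ (∫ y in Ioo (-t) t, K (x + y) * (φ : ℝ → ℝ) y) ^ 2) := by
      have := (memLp_two_iff_integrable_sq_norm hh2.1).1 hh2
      exact this.congr (Eventually.of_forall fun x ↦ by simp [sq_abs])
    have h1 : ‖A φ‖ ^ 2 ≤ ‖φ‖ ^ 2 := by
      rw [hnormA, norm_Lp_sq]
      exact (setIntegral_le_integral hsq (Eventually.of_forall fun x ↦ sq_nonneg _)).trans hcontr
    exact (pow_le_pow_iff_left₀ (norm_nonneg _) (norm_nonneg _) two_ne_zero).1 h1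
  have hAnorm : ‖A‖ ≤ 1 :=
    ContinuousLinearMap.opNorm_le_bound _ zero_le_one fun φ ↦ by simpa using hA1 φ
  -- clause ii) in operator form
  have hii : ∀ φ : Lp ℝ 2 μ, φ ≠ 0 → ‖A φ‖ ≠ ‖φ‖ := by
    intro φ hφ0 heq
    have hφ : MemLp (φ : ℝ → ℝ) 2 μ := Lp.memLp φ
    have hne : ¬ (φ : ℝ → ℝ) =ᵐ[μ] 0 := fun h0 ↦ hφ0 (Lp.eq_zero_iff_ae_eq_zero.2 h0)
    refine Suzuki2021_prop44_ii hω hν hνω hE ht.le hφ hne ?_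
    rw [← hnormA, ← norm_Lp_sq, heq]
  -- `T = A ∘ A` is compact, self-adjoint and positive
  have hTc : IsCompactOperator (A * A) := hcomp.comp_clm A
  have hTsa : IsSelfAdjoint (A * A) := by rw [← sq]; exact hsa'.pow 2
  have hTpos : ∀ x : Lp ℝ 2 μ, 0 ≤ RCLike.re ⟪x, (A * A) x⟫ := by
    intro x
    rw [mul_apply_eq_comp, RCLike.re_to_real, ← ContinuousLinearMap.adjoint_inner_left,
      hsa'.adjoint_eq]
    exact real_inner_self_nonneg
  obtain ⟨Ω, hΩ1, hΩ⟩ := exists_eigenvector_norm_of_re_inner_nonneg hTsa hTc hTpos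
  have hCstar : ‖A * A‖ = ‖A‖ * ‖A‖ := by
    have := CStarRing.norm_star_mul_self (x := A)
    rwa [hsa'.star_eq] at this
  -- `‖A‖ < 1`
  have hlt : ‖A‖ < 1 := by
    refine lt_of_le_of_ne hAnorm fun h1 ↦ ?_
    have hT1 : ‖A * A‖ = 1 := by rw [hCstar, h1, one_mul]
    have hΩ' : A (A Ω) = Ω := by
      have := hΩ
      rw [hT1, mul_apply_eq_comp] at this
      simpa using this
    have hAΩ : ‖A Ω‖ = ‖Ω‖ := by
      have h2 : ‖A Ω‖ ^ 2 = ‖Ω‖ ^ 2 := by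
        rw [← real_inner_self_eq_norm_sq, ← real_inner_self_eq_norm_sq,
          ← ContinuousLinearMap.adjoint_inner_left, hsa'.adjoint_eq, hΩ']
      exact (pow_left_inj₀ (norm_nonneg _) (norm_nonneg _) two_ne_zero).1 h2
    have hΩ0 : Ω ≠ 0 := by
      rintro rfl; rw [norm_zero] at hΩ1; exact zero_ne_one hΩ1
    exact hii Ω hΩ0 hAΩ
  refine ⟨‖A‖ ^ 2, by nlinarith [norm_nonneg A], fun f hf ↦ ?_⟩
  set φ : Lp ℝ 2 μ := hf.toLp f with hφ
  calc ∫ x in Ioo (-t) t, (∫ y in Ioo (-t) t, K (x + y) * f y) ^ 2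
      = ∫ x in Ioo (-t) t, (∫ y in Ioo (-t) t, K (x + y) * φ y) ^ 2 := by
        simp_rw [hφ, himg f hf]
    _ = ‖A φ‖ ^ 2 := (hnormA φ).symm
    _ ≤ (‖A‖ * ‖φ‖) ^ 2 := pow_le_pow_left₀ (norm_nonneg _) (A.le_opNorm φ) 2
    _ = ‖A‖ ^ 2 * ∫ x in Ioo (-t) t, f x ^ 2 := by rw [mul_pow, hφ, norm_toLp_sq hf]

end SuzukiWindowNorm

open SuzukiWindowNorm in
/-- **[Su21] Prop. 4.4 ii)–iii) for `L = ζ` — DISCHARGE of the named fact `Suzuki2021_prop44_norm`**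
(the rh-dbr column's `OpNormWindow`; RH-FREE AS TYPED, `HB̄` explicit): for `ω > 0`, `ν ≥ 1`,
`νω > 1`, `E_ζ^{ω,ν} ∈ HB̄` and `t ≥ 0`: ii) `‖𝖪[t]f‖ ≠ ‖f‖` for `f ≠ 0` (`Suzuki2021_prop44_ii`),
and iii) `∃ c < 1, ‖𝖪[t]f‖² ≤ c‖f‖²` («`‖𝖪[t]‖ < 1`»; `exists_lt_one_bound` for `t > 0`, the empty
window `t = 0` by hand). [cite: Suzuki2021Hamiltonians, Prop. 4.4 ii)–iii)] -/
theorem Suzuki2021_prop44_norm_holds : Suzuki2021_prop44_norm := by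
  intro ω hω ν hν hνω hE t ht
  refine ⟨fun f hf hf0 ↦ Suzuki2021_prop44_ii hω hν hνω hE ht hf hf0, ?_⟩
  rcases eq_or_lt_of_le ht with h0 | htpos
  · subst h0
    refine ⟨0, zero_lt_one, fun f _ ↦ ?_⟩
    simp
  · exact exists_lt_one_bound hω hν hνω hE htpos

/-- **The model regime, operator-norm form (Prop. 2.2 + Prop. 4.4 ii)–iii)) — HYPOTHESIS-FREE for
`ω ≥ ½`:** for `ω ≥ ½`, `ν ≥ 1`, `νω > 1` and every `t ≥ 0`, clauses ii) and iii) of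
`Suzuki2021_prop44_norm` hold outright («`‖𝖪_ζ^{ω,ν}[t]‖ < 1` on the whole half-line»), because
`E_ζ^{ω,ν} ∈ HB ⊆ HB̄` there is the tree theorem `Suzuki2021_prop22_holds`. RH-FREE (the regime
`ω < ½` is untouched). [cite: Suzuki2021Hamiltonians, Prop. 2.2 and Prop. 4.4 ii)–iii)] -/
theorem suzuki2021_opNormWindow_of_half_le {ω : ℝ} (hω : 1 / 2 ≤ ω) {ν : ℕ} (hν : 1 ≤ ν)
    (hνω : 1 < (ν : ℝ) * ω) {t : ℝ} (ht : 0 ≤ t) :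
    (∀ f : ℝ → ℝ, MemLp f 2 (volume.restrict (Ioo (-t) t)) →
        ¬ (f =ᵐ[volume.restrict (Ioo (-t) t)] 0) →
        ∫ x in Ioo (-t) t, (∫ y in Ioo (-t) t, suzukiKernel ω ν (x + y) * f y) ^ 2 ≠
          ∫ x in Ioo (-t) t, f x ^ 2) ∧
    (∃ c : ℝ, c < 1 ∧ ∀ f : ℝ → ℝ, MemLp f 2 (volume.restrict (Ioo (-t) t)) →
        ∫ x in Ioo (-t) t, (∫ y in Ioo (-t) t, suzukiKernel ω ν (x + y) * f y) ^ 2 ≤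
          c * ∫ x in Ioo (-t) t, f x ^ 2) :=
  Suzuki2021_prop44_norm_holds ω (by linarith) ν hν hνω
    ((isSuzukiHB_iff _).1 (Suzuki2021_prop22_holds ω hω ν hν)).1 t ht

/-- **RH-CONSEQUENCE form (explicit binder; Prop. 2.1/4.3 + Prop. 4.4 ii)–iii)):** under Mathlib's
`RiemannHypothesis`, for EVERY `ω > 0`, `ν ≥ 1` with `νω > 1` and every `t ≥ 0`, clauses ii) and
iii) of `Suzuki2021_prop44_norm` hold («`‖𝖪_ζ^{ω,ν}[t]‖ < 1`»), via the tree's RH-EQUIVALENT frame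
`riemannHypothesis_iff_forall_isSuzukiHB`. LABEL: RH-CONSEQUENCE with the hypothesis explicit — an
implication FROM RH, proved as such; nothing here bears on the truth of RH.
[cite: Suzuki2021Hamiltonians, Prop. 2.1, Prop. 4.3 and Prop. 4.4 ii)–iii)] -/
theorem suzuki2021_opNormWindow_of_riemannHypothesis (hRH : RiemannHypothesis) {ω : ℝ} (hω : 0 < ω)
    {ν : ℕ} (hν : 1 ≤ ν) (hνω : 1 < (ν : ℝ) * ω) {t : ℝ} (ht : 0 ≤ t) :
    (∀ f : ℝ → ℝ, MemLp f 2 (volume.restrict (Ioo (-t) t)) →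
        ¬ (f =ᵐ[volume.restrict (Ioo (-t) t)] 0) →
        ∫ x in Ioo (-t) t, (∫ y in Ioo (-t) t, suzukiKernel ω ν (x + y) * f y) ^ 2 ≠
          ∫ x in Ioo (-t) t, f x ^ 2) ∧
    (∃ c : ℝ, c < 1 ∧ ∀ f : ℝ → ℝ, MemLp f 2 (volume.restrict (Ioo (-t) t)) →
        ∫ x in Ioo (-t) t, (∫ y in Ioo (-t) t, suzukiKernel ω ν (x + y) * f y) ^ 2 ≤
          c * ∫ x in Ioo (-t) t, f x ^ 2) :=
  Suzuki2021_prop44_norm_holds ω hω ν hν hνω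
    ((isSuzukiHB_iff _).1 ((riemannHypothesis_iff_forall_isSuzukiHB hν).1 hRH ω hω)).1 t ht

end Literature.NumberTheory.LFunctions
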